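/-
Copyright (c) 2026 the pub-hodgecm-mathlib formalisation cell (harness21).  Prover seat hodgecm-mathlib-K2E5-p16 (g4): Track B «K2-LIT»,
hLiu418 = stmt-HodgeConjecture-24832, ROAD Φ organ Φ6b-3 (dealer K2E5-plan (g5) GO 2026-09-04T06:21:58Z): THE ξ–η IDENTITY
`ξ(g, h; α, β) = 4π⁴ · e^{iπ(β−α)} · Γ₂(α)⁻¹ Γ₂(β)⁻¹ · η(2g, πh; α, β)` for `g, h > 0` — Shimura's continuation mechanism, Case II, m = 2; 2026-09-04.
-/
import Summits.HodgeConjecture.HodgeConjecture.Theorems.K2LiuHermTwoGammaKernelInversion      -- ★ (this seat): Fourier inversion of the kernel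
import Summits.HodgeConjecture.HodgeConjecture.Theorems.K2LiuHermTwoEtaDefs                    -- ★ (this seat): `etaTwo`
import Mathlib.MeasureTheory.Group.Measure
import HarnessLib

/-!
# Crux `HLiu418`, ROAD Φ, organ Φ6b-3: the ξ–η IDENTITY on `Herm₂(ℂ)` [Shimura1982, (1.29)∕Thm 3.1 mechanism, Case II, m = κ = 2]
# `ξ(g, h; α, β) = 4π⁴ · e^{iπ(β−α)} · Γ₂(α)⁻¹ Γ₂(β)⁻¹ · η(2g, πh; α, β)`   (`g, h > 0`, `re α > 3`, `re β > 1`)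

Cell `hodgecm-mathlib`, crux item hLiu418 = `stmt-HodgeConjecture-24832`, route of record `HCCMUnconditional`; squad K2, LEAD F0P6-plan (g12), co-dealer
K2E5-plan (g5) («the ξ–η identity IS the continuation mechanism (η continues, Γ₂⁻¹ entire), critical path of #41's archimedean organ in BOTH columns»),
prover K2E5-p16 (g4).  THEOREMS ONLY (no `def`, no instance, no notation, no named-fact hypothesis, no `sorry`); lane `--supports stmt-HodgeConjecture-24832 --as helper`.

THE IDENTITY.  For positive definite Hermitian `2 × 2` matrices `g, h` and `re α > 3`, `re β > 1`:
  `ξ(g, h; α, β) = 4π⁴ · e^{iπ(β−α)} · Γ₂(α)⁻¹ · Γ₂(β)⁻¹ · η(2g, πh; α, β)`,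
`ξ = xiTwo` (★ `K2LiuHermTwoConfluentXiDefs`), `η = etaTwo` (★ `K2LiuHermTwoEtaDefs`), `Γ₂ = hermTwoGamma`; the `m = 1` shape is the classical
`ξ = 2π i^{β−α}Γ(α)⁻¹Γ(β)⁻¹η(2g,πh;α,β)` and here `(2π)⁴/4 = 4π⁴ = 2^m π^{mκ}`.  Since `η(2g, πh; ·, β)` converges for EVERY `α` when `h > 0`
(★ `integrableOn_etaTwoIntegrand_of_posDef`) and `Γ₂(α)⁻¹` is entire, the right-hand side is the analytic continuation of `ξ` in `α`
(Shimura's Theorem 3.1 for `h > 0`; holomorphy of `η` in `α` is the routine sequel).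
PROOF.  (1) `det(g + ix)^{−β} = Γ₂(β)⁻¹ ∫_u φ_β(u) e^{−iτ(ux)} du` (★ `integral_gammaKernel_mul_cexp_trace`); (2) FUBINI on `Herm₂ × Herm₂` (the double
integrand is dominated by `|det(g − ix)|^{−re α} e^{π|im α|} · |φ_β(u)|`, ★ `Integrable.mul_prod`); (3) the phases combine, `e(−τ(hx)) e^{−iτ(ux)} =
e^{−iτ((u + 2πh)x)}`, and the inner `x`-integral is ★ `integral_cexp_trace_mul_det_cpow` (FOURIER INVERSION) at the cone point `w = u + 2πh`:
`4π⁴ Γ₂(α)⁻¹ e^{−τ(wg)} det(w)^{α−2}`; (4) `φ_β(u) e^{−τ((u+2πh)g)} det(u+2πh)^{α−2} = e^{−τ((u+πh)·2g)} det((u+πh)+πh)^{α−2} det((u+πh)−πh)^{β−2}` and the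
translation `x = u + πh` (★ `MeasurePreserving` of the product translations) turns `∫_{u>0}` into `η(2g, πh; α, β) = ∫_{x − πh > 0}` (★ `etaTwoSet_eq_of_posSemidef`).
HONEST LABEL.  Count-neutral helper of the K2_Liu road; it pays no socket by itself: `HC_CM` is proved only modulo the 7 printed citations
(2 remaining named inputs: hLiu418 = `stmt-HodgeConjecture-24832`, h413 = `stmt-HodgeConjecture-24833`) until rung 0 closes.
-/

set_option autoImplicit false
-- the mandated namespace repeats the single-problem summit's segment (`HodgeConjecture.HodgeConjecture`)
set_option linter.dupNamespace false

noncomputable section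

open Complex MeasureTheory Set WithLp
open scoped ComplexOrder ComplexConjugate RealInnerProductSpace FourierTransform

namespace Summit.HodgeConjecture.HodgeConjecture.Cruxes.HLiu418.K2LiuHermTwoXiEtaIdentity

open Summit.HodgeConjecture.HodgeConjecture.Cruxes.HLiu418.K2LiuHermTwoGammaDefs
open Summit.HodgeConjecture.HodgeConjecture.Cruxes.HLiu418.K2LiuHermTwoGammaSiegelGindikin
open Summit.HodgeConjecture.HodgeConjecture.Cruxes.HLiu418.K2LiuHermTwoGammaKernelFourier
open Summit.HodgeConjecture.HodgeConjecture.Cruxes.HLiu418.K2LiuHermTwoGammaKernelInversion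
open Summit.HodgeConjecture.HodgeConjecture.Cruxes.HLiu418.K2LiuHermTwoDetPowerIntegrable
open Summit.HodgeConjecture.HodgeConjecture.Cruxes.HLiu418.K2LiuHermTwoConfluentXiDefs
open Summit.HodgeConjecture.HodgeConjecture.Cruxes.HLiu418.K2LiuHermTwoConfluentXiConvergence
open Summit.HodgeConjecture.HodgeConjecture.Cruxes.HLiu418.K2LiuHermTwoEtaDefs

/-! ## Chart identities -/

/-- A positive multiple of a cone point is a cone point. -/
theorem posDef_hermTwo_smul {r : ℝ} (hr : 0 < r) {e : ℝ × ℂ × ℝ} (he : (hermTwo e).PosDef) : (hermTwo (r • e)).PosDef := by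
  have h := (posDef_hermTwo_iff e).mp he
  refine (posDef_hermTwo_iff (r • e)).mpr ?_
  simp only [Prod.smul_fst, Prod.smul_snd, smul_eq_mul, Complex.real_smul, map_mul, normSq_ofReal]
  refine ⟨mul_pos hr h.1, ?_⟩
  have : 0 < r * r := mul_pos hr hr
  nlinarith [h.2]

/-- The sum of two cone points is a cone point. -/
theorem posDef_hermTwo_add {u e : ℝ × ℂ × ℝ} (hu : (hermTwo u).PosDef) (he : (hermTwo e).PosDef) : (hermTwo (u + e)).PosDef := by
  rw [hermTwo_add]
  exact hu.add_posSemidef he.posSemidef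

/-- The phases combine: `e(−τ(h x)) · e^{−iτ(u x)} = e^{−iτ((u + 2πh) x)}` (`h = hermTwo e`). -/
theorem phase_combine (e u c : ℝ × ℂ × ℝ) :
    cexp (-(2 * Real.pi * I) * (hermTwo e * hermTwo c).trace) * cexp (-(I * (hermTwo u * hermTwo c).trace)) =
      cexp (-(I * (hermTwo (u + (2 * Real.pi) • e) * hermTwo c).trace)) := by
  rw [← Complex.exp_add, hermTwo_add, hermTwo_smul, Matrix.add_mul, Matrix.smul_mul, Matrix.trace_add, Matrix.trace_smul,
    smul_eq_mul]
  congr 1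
  push_cast
  ring

/-- The exponents combine: `τ(u g) + τ((u + 2πh) g) = τ((u + πh)(2g))`. -/
theorem trace_combine (g : Matrix (Fin 2) (Fin 2) ℂ) (e u : ℝ × ℂ × ℝ) :
    (hermTwo u * g).trace + (hermTwo (u + (2 * Real.pi) • e) * g).trace = (hermTwo (u + Real.pi • e) * ((2 : ℂ) • g)).trace := by
  have hvec : u + (2 * Real.pi) • e = (2 : ℝ) • (u + Real.pi • e) - u := by
    ext <;> simp [two_smul, smul_add, two_mul] <;> ring
  rw [hvec, hermTwo_sub, hermTwo_smul, Matrix.sub_mul, Matrix.smul_mul, Matrix.trace_sub, Matrix.trace_smul, Matrix.mul_smul,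
    Matrix.trace_smul, smul_eq_mul, smul_eq_mul]
  push_cast
  ring

/-! ## The inner integral: Fourier inversion at `w = u + 2πh` -/

/-- For `u` in the cone: `∫_x e(−τ(hx)) e^{−iτ(ux)} det(g − ix)^{−α} dx = 4π⁴ Γ₂(α)⁻¹ e^{−τ((u+2πh)g)} det(u+2πh)^{α−2}`. -/
theorem inner_integral_eq {g : Matrix (Fin 2) (Fin 2) ℂ} (hg : g.PosDef) {e : ℝ × ℂ × ℝ} (he : (hermTwo e).PosDef) {α : ℂ} (hα : 3 < α.re)
    {u : ℝ × ℂ × ℝ} (hu : (hermTwo u).PosDef) :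
    ∫ c : ℝ × ℂ × ℝ, cexp (-(2 * Real.pi * I) * (hermTwo e * hermTwo c).trace) * cexp (-(I * (hermTwo u * hermTwo c).trace)) *
        (g - I • hermTwo c).det ^ (-α) =
      ((4 * Real.pi ^ 4 : ℝ) : ℂ) * (hermTwoGamma α)⁻¹ *
        (cexp (-(hermTwo (u + (2 * Real.pi) • e) * g).trace) * (hermTwo (u + (2 * Real.pi) • e)).det ^ (α - 2)) := by
  have hw : (hermTwo (u + (2 * Real.pi) • e)).PosDef := posDef_hermTwo_add hu (posDef_hermTwo_smul (by positivity) he)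
  have hΓ : hermTwoGamma α ≠ 0 := hermTwoGamma_ne_zero (by linarith)
  have key := integral_cexp_trace_mul_det_cpow hg hα hw
  have h1 : (fun c : ℝ × ℂ × ℝ => cexp (-(2 * Real.pi * I) * (hermTwo e * hermTwo c).trace) *
      cexp (-(I * (hermTwo u * hermTwo c).trace)) * (g - I • hermTwo c).det ^ (-α)) =
      fun c => (hermTwoGamma α)⁻¹ * (cexp (-(I * (hermTwo (u + (2 * Real.pi) • e) * hermTwo c).trace)) *
        (hermTwoGamma α * (g - I • hermTwo c).det ^ (-α))) := by
    funext c
    rw [phase_combine]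
    field_simp
  rw [h1, integral_const_mul, key]
  ring

/-! ## Fubini for the double integral -/

/-- `x ↦ det(g − ix)^{−α}` is integrable for `re α > 3`. -/
theorem integrable_det_sub_cpow {g : Matrix (Fin 2) (Fin 2) ℂ} (hg : g.PosDef) {α : ℂ} (hα : 3 < α.re) :
    Integrable (fun c : ℝ × ℂ × ℝ => (g - I • hermTwo c).det ^ (-α)) := by
  refine ((integrable_norm_det_add_I_smul_rpow_neg hg hα).const_mul (Real.exp (Real.pi * |α.im|))).mono' ?_ ?_
  · exact ((continuous_det_sub_I_smul_hermTwo g).measurable.pow_const _).aestronglyMeasurable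
  · refine Filter.Eventually.of_forall fun c => ?_
    have hne : (g - I • hermTwo c).det ≠ 0 := by
      rw [det_sub_I_smul_eq_conj hg c]
      exact (map_ne_zero _).mpr (norm_pos_iff.mp (norm_det_add_I_smul_pos hg c))
    have h := norm_cpow_neg_le hne α
    have hn : ‖(g - I • hermTwo c).det‖ = ‖(g + I • hermTwo c).det‖ := by
      rw [det_sub_I_smul_eq_conj hg c, Complex.norm_conj]
    rw [hn] at h
    simpa only [Pi.mul_apply] using h

/-- The double integrand `G(x, u) = e(−τ(hx)) det(g − ix)^{−α} · φ_β(u) e^{−iτ(ux)}` is integrable on `Herm₂ × Herm₂`. -/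
theorem integrable_double {g : Matrix (Fin 2) (Fin 2) ℂ} (hg : g.PosDef) (e : ℝ × ℂ × ℝ) {α β : ℂ} (hα : 3 < α.re) (hβ : 1 < β.re) :
    Integrable (Function.uncurry fun (c : ℝ × ℂ × ℝ) (u : ℝ × ℂ × ℝ) =>
      cexp (-(2 * Real.pi * I) * (hermTwo e * hermTwo c).trace) * (g - I • hermTwo c).det ^ (-α) *
        ({x : ℝ × ℂ × ℝ | (hermTwo x).PosDef}.indicator (fun x => cexp (-(hermTwo x * g).trace) * (hermTwo x).det ^ (β - 2)) u *
          cexp (-(I * (hermTwo u * hermTwo c).trace))))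
      ((volume : Measure (ℝ × ℂ × ℝ)).prod (volume : Measure (ℝ × ℂ × ℝ))) := by
  have hprod := (integrable_det_sub_cpow hg hα).mul_prod (integrable_gammaKernel hg hβ)
  refine hprod.norm.mono' ?_ (Filter.Eventually.of_forall fun p => ?_)
  · -- measurability
    have h1 : Continuous fun p : (ℝ × ℂ × ℝ) × (ℝ × ℂ × ℝ) => (hermTwo e * hermTwo p.1).trace :=
      (continuous_trace_mul_hermTwo (hermTwo e)).comp continuous_fst
    have h2 : Measurable fun p : (ℝ × ℂ × ℝ) × (ℝ × ℂ × ℝ) => (g - I • hermTwo p.1).det ^ (-α) :=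
      ((continuous_det_sub_I_smul_hermTwo g).comp continuous_fst).measurable.pow_const _
    have h3 : Measurable fun p : (ℝ × ℂ × ℝ) × (ℝ × ℂ × ℝ) =>
        {x : ℝ × ℂ × ℝ | (hermTwo x).PosDef}.indicator (fun x => cexp (-(hermTwo x * g).trace) * (hermTwo x).det ^ (β - 2)) p.2 :=
      (measurable_gammaKernel g β).comp measurable_snd
    have h4 : Continuous fun p : (ℝ × ℂ × ℝ) × (ℝ × ℂ × ℝ) => (hermTwo p.2 * hermTwo p.1).trace := by
      have hf : (fun p : (ℝ × ℂ × ℝ) × (ℝ × ℂ × ℝ) => (hermTwo p.2 * hermTwo p.1).trace) = fun p =>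
          ((p.2.1 * p.1.1 + p.2.2.2 * p.1.2.2 + 2 * (p.2.2.1 * conj p.1.2.1).re : ℝ) : ℂ) :=
        funext fun p => trace_hermTwo_mul_hermTwo p.2 p.1
      rw [hf]
      fun_prop
    exact (((Complex.measurable_exp.comp (measurable_const.mul h1.measurable)).mul h2).mul
      (h3.mul (Complex.measurable_exp.comp (measurable_const.mul h4.measurable).neg))).aestronglyMeasurable
  · -- domination `‖G(x,u)‖ ≤ ‖det(g − ix)^{−α}‖ · ‖φ_β(u)‖`
    obtain ⟨c, u⟩ := p
    simp only [Function.uncurry_apply_pair, norm_mul]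
    have hE : ‖cexp (-(2 * Real.pi * I) * (hermTwo e * hermTwo c).trace)‖ = 1 := by
      rw [trace_hermTwo_mul_hermTwo, Complex.norm_exp]
      simp
    have hP : ‖cexp (-(I * (hermTwo u * hermTwo c).trace))‖ = 1 := by
      rw [trace_hermTwo_mul_hermTwo, Complex.norm_exp]
      simp
    rw [hE, hP, one_mul, mul_one]

/-! ## The outer integral: translation to `η(2g, πh; α, β)` -/

/-- `∫_{u > 0} e^{−τ(ug)} det(u)^{β−2} · e^{−τ((u+2πh)g)} det(u + 2πh)^{α−2} du = η(2g, πh; α, β)` (translation `x = u + πh`, `h = hermTwo e > 0`). -/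
theorem integral_kernel_shift_eq_etaTwo (g : Matrix (Fin 2) (Fin 2) ℂ) {e : ℝ × ℂ × ℝ} (he : (hermTwo e).PosDef) (α β : ℂ) :
    ∫ u : ℝ × ℂ × ℝ, {x : ℝ × ℂ × ℝ | (hermTwo x).PosDef}.indicator (fun x => cexp (-(hermTwo x * g).trace) * (hermTwo x).det ^ (β - 2)) u *
        (cexp (-(hermTwo (u + (2 * Real.pi) • e) * g).trace) * (hermTwo (u + (2 * Real.pi) • e)).det ^ (α - 2)) =
      etaTwo ((2 : ℂ) • g) ((Real.pi : ℂ) • hermTwo e) α β := by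
  have hπe : (hermTwo (Real.pi • e)).PosDef := posDef_hermTwo_smul Real.pi_pos he
  rw [← hermTwo_smul Real.pi e, etaTwo_def, etaTwoSet_eq_of_posSemidef hπe.posSemidef]
  -- the translation `x = u + πh` preserves Lebesgue measure
  have hT : MeasurePreserving (fun c : ℝ × ℂ × ℝ => c + Real.pi • e) volume volume := by
    have h := (measurePreserving_add_right (volume : Measure ℝ) (Real.pi • e).1).prod
      ((measurePreserving_add_right (volume : Measure ℂ) (Real.pi • e).2.1).prod
        (measurePreserving_add_right (volume : Measure ℝ) (Real.pi • e).2.2))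
    have hf : (fun c : ℝ × ℂ × ℝ => c + Real.pi • e) =
        Prod.map (fun x : ℝ => x + (Real.pi • e).1) (Prod.map (fun x : ℂ => x + (Real.pi • e).2.1) (fun x : ℝ => x + (Real.pi • e).2.2)) := by
      funext c
      rfl
    rw [hf, Measure.volume_eq_prod, Measure.volume_eq_prod]
    exact h
  have hTe : MeasurableEmbedding (fun c : ℝ × ℂ × ℝ => c + Real.pi • e) := (MeasurableEquiv.addRight (Real.pi • e)).measurableEmbedding
  have hpre : (fun c : ℝ × ℂ × ℝ => c + Real.pi • e) ⁻¹' {c | (hermTwo c - hermTwo (Real.pi • e)).PosDef} = {c | (hermTwo c).PosDef} := by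
    ext c
    simp only [Set.mem_preimage, Set.mem_setOf_eq, hermTwo_add, add_sub_cancel_right]
  rw [← hT.setIntegral_preimage_emb hTe _ {c | (hermTwo c - hermTwo (Real.pi • e)).PosDef}, hpre,
    ← integral_indicator measurableSet_posDef_hermTwo]
  refine integral_congr_ae (Filter.Eventually.of_forall fun u => ?_)
  beta_reduce
  by_cases hu : (hermTwo u).PosDef
  · rw [gammaKernel_eq_of_posDef g β hu, indicator_of_mem (show u ∈ {c : ℝ × ℂ × ℝ | (hermTwo c).PosDef} from hu),
      etaTwoIntegrand_apply]
    have hadd : hermTwo (u + Real.pi • e) + hermTwo (Real.pi • e) = hermTwo (u + (2 * Real.pi) • e) := by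
      rw [← hermTwo_add, two_mul, add_smul, add_assoc]
    have hsub : hermTwo (u + Real.pi • e) - hermTwo (Real.pi • e) = hermTwo u := by
      rw [hermTwo_add, add_sub_cancel_right]
    rw [hadd, hsub, ← trace_combine g e u, neg_add, Complex.exp_add]
    ring
  · rw [gammaKernel_eq_zero_of_not_posDef g β hu, indicator_of_notMem (show u ∉ {c : ℝ × ℂ × ℝ | (hermTwo c).PosDef} from hu),
      zero_mul]

/-! ## The identity -/

/-- **THE ξ–η IDENTITY** (organ Φ6b-3; [Shimura1982, (1.29), Case II, m = κ = 2]): for positive definite Hermitian `2 × 2` matrices `g, h` and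
`re α > 3`, `re β > 1`,
  `ξ(g, h; α, β) = 4π⁴ · e^{iπ(β−α)} · Γ₂(α)⁻¹ · Γ₂(β)⁻¹ · η(2g, πh; α, β)`. -/
theorem xiTwo_eq_etaTwo {g h : Matrix (Fin 2) (Fin 2) ℂ} (hg : g.PosDef) (hh : h.PosDef) {α β : ℂ} (hα : 3 < α.re) (hβ : 1 < β.re) :
    xiTwo g h α β =
      ((4 * Real.pi ^ 4 : ℝ) : ℂ) * cexp ((Real.pi * I) * (β - α)) * (hermTwoGamma α)⁻¹ * (hermTwoGamma β)⁻¹ *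
        etaTwo ((2 : ℂ) • g) ((Real.pi : ℂ) • h) α β := by
  -- coordinates of `h`
  obtain ⟨e, rfl⟩ : ∃ e : ℝ × ℂ × ℝ, hermTwo e = h := ⟨_, hermTwo_eq_of_isHermitian hh.1⟩
  have hΓα : hermTwoGamma α ≠ 0 := hermTwoGamma_ne_zero (by linarith)
  have hΓβ : hermTwoGamma β ≠ 0 := hermTwoGamma_ne_zero hβ
  -- (1) insert the tube formula for `det(g + ix)^{−β}` and (2) Fubini
  have hG := integrable_double hg e hα hβ
  have step1 : xiTwo g (hermTwo e) α β = cexp ((Real.pi * I) * (β - α)) * (hermTwoGamma β)⁻¹ *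
      ∫ c : ℝ × ℂ × ℝ, ∫ u : ℝ × ℂ × ℝ,
        cexp (-(2 * Real.pi * I) * (hermTwo e * hermTwo c).trace) * (g - I • hermTwo c).det ^ (-α) *
          ({x : ℝ × ℂ × ℝ | (hermTwo x).PosDef}.indicator (fun x => cexp (-(hermTwo x * g).trace) * (hermTwo x).det ^ (β - 2)) u *
            cexp (-(I * (hermTwo u * hermTwo c).trace))) := by
    rw [xiTwo_def, ← integral_const_mul]
    refine integral_congr_ae (Filter.Eventually.of_forall fun c => ?_)
    beta_reduce
    rw [xiTwoIntegrand_eq, integral_const_mul, integral_gammaKernel_mul_cexp_trace hg hβ c]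
    field_simp
  rw [step1, integral_integral_swap hG]
  -- (3) the inner integral, pointwise in `u`
  have step3 : (fun u : ℝ × ℂ × ℝ => ∫ c : ℝ × ℂ × ℝ,
        cexp (-(2 * Real.pi * I) * (hermTwo e * hermTwo c).trace) * (g - I • hermTwo c).det ^ (-α) *
          ({x : ℝ × ℂ × ℝ | (hermTwo x).PosDef}.indicator (fun x => cexp (-(hermTwo x * g).trace) * (hermTwo x).det ^ (β - 2)) u *
            cexp (-(I * (hermTwo u * hermTwo c).trace)))) =
      fun u => ((4 * Real.pi ^ 4 : ℝ) : ℂ) * (hermTwoGamma α)⁻¹ *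
        ({x : ℝ × ℂ × ℝ | (hermTwo x).PosDef}.indicator (fun x => cexp (-(hermTwo x * g).trace) * (hermTwo x).det ^ (β - 2)) u *
          (cexp (-(hermTwo (u + (2 * Real.pi) • e) * g).trace) * (hermTwo (u + (2 * Real.pi) • e)).det ^ (α - 2))) := by
    funext u
    by_cases hu : (hermTwo u).PosDef
    · have h1 : (fun c : ℝ × ℂ × ℝ =>
          cexp (-(2 * Real.pi * I) * (hermTwo e * hermTwo c).trace) * (g - I • hermTwo c).det ^ (-α) *
            ({x : ℝ × ℂ × ℝ | (hermTwo x).PosDef}.indicator (fun x => cexp (-(hermTwo x * g).trace) * (hermTwo x).det ^ (β - 2)) u *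
              cexp (-(I * (hermTwo u * hermTwo c).trace)))) =
          fun c => {x : ℝ × ℂ × ℝ | (hermTwo x).PosDef}.indicator
              (fun x => cexp (-(hermTwo x * g).trace) * (hermTwo x).det ^ (β - 2)) u *
            (cexp (-(2 * Real.pi * I) * (hermTwo e * hermTwo c).trace) * cexp (-(I * (hermTwo u * hermTwo c).trace)) *
              (g - I • hermTwo c).det ^ (-α)) := by
        funext c
        ring
      rw [h1, integral_const_mul, inner_integral_eq hg hh hα hu]
      ring
    · rw [gammaKernel_eq_zero_of_not_posDef g β hu]
      simp
  rw [step3, integral_const_mul, integral_kernel_shift_eq_etaTwo g hh α β]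
  ring

end Summit.HodgeConjecture.HodgeConjecture.Cruxes.HLiu418.K2LiuHermTwoXiEtaIdentity

end
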